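import Literature.MathematicalPhysics.QuantumLattice.HubbardUVSymbolSmooth
import HarnessLib

/-!
# The SHIFTED ultraviolet-block symbol `w_{Λ₀}·p_θ` as a `C²` function of frequency and of momentum: `|∂²| ≲ βL²/(Λ₀(ω²+ξ²+Λ₀²))`

Topic `MathematicalPhysics/QuantumLattice`; the continuum side of the `L¹` bound of the ultraviolet block (cell gate-hubbard-kl, R0-SCOPE-4
W2e), the `θ ≠ 0` companion of `HubbardUVSymbolSmooth` (whose weight `uvWeightFn` and weight lemmas are reused) and of
`HubbardSliceSymbolSmooth(Momentum)`.  The block above the infrared scale at a complex (Hartree-shifted) chemical potential,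
`top + uv = w_{Λ₀}·p_θ` (`HubbardUVBlockDetBound`), has the symbol `Ψ(ω) = W(ω)R(ω)` with the single weight `W = χ₂((ω²+ξ²)/Λ₀²)`
(vanishing below `Λ₀/2`, one above `Λ₀`) and the SHIFTED resolvent `R = c/(-i(ω+θ)+ξ)`; it is not compactly supported, and its second
derivatives decay like the resolvent's: for `|θ| ≤ Λ₀/4`, `0 < Λ₀ ≤ 1`, `c ≥ 0`,

`‖∂_ω² Ψ‖, ‖∂_ξ² Ψ̂‖ ≤ K c/(Λ₀(ω²+ξ²+Λ₀²))`, `‖∂_p² Φ‖ ≤ K′ c/(Λ₀(ω²+ξ²+Λ₀²))`, `‖Ψ‖² ≤ 20c²/(ω²+ξ²+Λ₀²)`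

(`K = 32B₂ + 144B₁ + 200`, `K′ = 4K + 32B₁ + 40`; Benfatto–Giuliani–Mastropietro 2006, App. A1: the ultraviolet propagator and its
derivatives decay like powers of the frequency).

* `sq_shiftDen_ge_of_ge` — `(ω+θ)²+ξ² ≥ (ω²+ξ²+Λ₀²)/20` above `Λ₀/2`;
* `uvShiftedSymbolFn/D1/D2` (frequency), `uvShiftedSymbolFnXi/D1/D2` (band variable), `uvShiftedMomentumSymbolFn/D1/D2` (momentum
  component): `hasDerivAt_…` everywhere and the three decay bounds; `uvShiftedSymbol_eq_uvShiftedSymbolFn`,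
  `uvShiftedSymbol_shift_eq_uvShiftedMomentumSymbolFn` (restriction to the lattice labels).

Everything is proved; the nine functions are the only definitions; no named facts.

## Sources

G. Benfatto, A. Giuliani, V. Mastropietro, Ann. Henri Poincaré 7 (2006) 809–898, §2.2 (2.10), App. A1 (`BenfattoGiulianiMastropietro2006`);
M. Salmhofer, *Renormalization* (1999), §4.2.5 (4.70)–(4.71) (`Salmhofer1999`).
-/

noncomputable section

namespace Literature.MathematicalPhysics.QuantumLattice

open Literature.Probability.LatticeModels Set Complex

/-! ### The denominator above `Λ₀/2` -/

/-- **Above `Λ₀/2` the denominator grows with the label**: `Λ₀²/4 ≤ ω²+ξ²`, `|θ| ≤ Λ₀/4` give `(ω²+ξ²+Λ₀²)/20 ≤ (ω+θ)²+ξ²`.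
[cite: BenfattoGiulianiMastropietro2006, §2.1 (2.3)] -/
theorem sq_shiftDen_ge_of_ge {Λ₀ θ ξ ω : ℝ} (hθ : |θ| ≤ Λ₀ / 4) (h : Λ₀ ^ 2 / 4 ≤ ω ^ 2 + ξ ^ 2) :
    (ω ^ 2 + ξ ^ 2 + Λ₀ ^ 2) / 20 ≤ (ω + θ) ^ 2 + ξ ^ 2 := by
  have hθ2 : θ ^ 2 ≤ Λ₀ ^ 2 / 16 := by
    have := sq_abs θ ▸ pow_le_pow_left₀ (abs_nonneg θ) hθ 2
    nlinarith
  nlinarith [sq_nonneg (ω + 2 * θ)]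

/-- Hence `‖-i(ω+θ)+ξ‖² ≥ (ω²+ξ²+Λ₀²)/20` and `‖-i(ω+θ)+ξ‖ ≥ Λ₀/5` above `Λ₀/2`. [cite: BenfattoGiulianiMastropietro2006, §2.1 (2.3)] -/
theorem norm_sq_shiftDen_ge_of_ge {Λ₀ θ ξ ω : ℝ} (hθ : |θ| ≤ Λ₀ / 4) (h : Λ₀ ^ 2 / 4 ≤ ω ^ 2 + ξ ^ 2) :
    (ω ^ 2 + ξ ^ 2 + Λ₀ ^ 2) / 20 ≤ ‖-I * ((ω + θ : ℝ) : ℂ) + (ξ : ℂ)‖ ^ 2 := by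
  rw [norm_sq_shiftDen]; exact sq_shiftDen_ge_of_ge hθ h

/-! ### The UV symbol as a function of the frequency -/

/-- `Ψ(ω) = W(ω) R(ω)`, `R = c/(-i(ω+θ)+ξ)`. [cite: BenfattoGiulianiMastropietro2006, §2.2 (2.10)] -/
def uvShiftedSymbolFn (c θ Λ₀ ξ ω : ℝ) : ℂ := (uvWeightFn Λ₀ ξ ω : ℂ) * resolventFn c θ ξ ω

/-- `Ψ′ = W′R + WR′`. [cite: BenfattoGiulianiMastropietro2006, §2.2 (2.10)] -/
def uvShiftedSymbolFnD1 (c θ Λ₀ ξ ω : ℝ) : ℂ :=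
  (uvWeightFnD1 Λ₀ ξ ω : ℂ) * resolventFn c θ ξ ω + (uvWeightFn Λ₀ ξ ω : ℂ) * resolventFnD1 c θ ξ ω

/-- `Ψ″ = W″R + 2W′R′ + WR″`. [cite: BenfattoGiulianiMastropietro2006, §2.2 (2.10)] -/
def uvShiftedSymbolFnD2 (c θ Λ₀ ξ ω : ℝ) : ℂ :=
  (uvWeightFnD2 Λ₀ ξ ω : ℂ) * resolventFn c θ ξ ω + 2 * ((uvWeightFnD1 Λ₀ ξ ω : ℂ) * resolventFnD1 c θ ξ ω) +
    (uvWeightFn Λ₀ ξ ω : ℂ) * resolventFnD2 c θ ξ ω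

section Freq

variable {c θ Λ₀ ξ : ℝ}

/-- **`Ψ` is differentiable everywhere.** [cite: BenfattoGiulianiMastropietro2006, (2.36aa)] -/
theorem hasDerivAt_uvShiftedSymbolFn (hΛ₀ : 0 < Λ₀) (hθ : |θ| ≤ Λ₀ / 4) (ω : ℝ) :
    HasDerivAt (uvShiftedSymbolFn c θ Λ₀ ξ) (uvShiftedSymbolFnD1 c θ Λ₀ ξ ω) ω := by
  by_cases h : Λ₀ ^ 2 / 5 < ω ^ 2 + ξ ^ 2
  · unfold uvShiftedSymbolFn uvShiftedSymbolFnD1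
    exact (hasDerivAt_uvWeightFn Λ₀ ξ ω).ofReal_comp.mul (hasDerivAt_resolventFn (shiftDen_ne_zero_of_gt hθ h))
  · have hlt : ω ^ 2 + ξ ^ 2 < Λ₀ ^ 2 / 4 := by linarith [not_lt.1 h, pow_pos hΛ₀ 2]
    have hopen : ∀ᶠ t in nhds ω, t ^ 2 + ξ ^ 2 < Λ₀ ^ 2 / 4 :=
      (continuous_pow 2 |>.add continuous_const).continuousAt.eventually_lt continuousAt_const hlt
    have hev : uvShiftedSymbolFn c θ Λ₀ ξ =ᶠ[nhds ω] fun _ => (0 : ℂ) := by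
      filter_upwards [hopen] with t ht
      rw [uvShiftedSymbolFn, (uvWeightFn_eq_zero_of_lt hΛ₀ ht).1, Complex.ofReal_zero, zero_mul]
    have hD1 : uvShiftedSymbolFnD1 c θ Λ₀ ξ ω = 0 := by
      obtain ⟨h0, h1, -⟩ := uvWeightFn_eq_zero_of_lt hΛ₀ hlt
      rw [uvShiftedSymbolFnD1, h0, h1, Complex.ofReal_zero, zero_mul, zero_mul, add_zero]
    rw [hD1]
    exact (hasDerivAt_const ω (0 : ℂ)).congr_of_eventuallyEq hev

/-- **`Ψ′` is differentiable everywhere.** [cite: BenfattoGiulianiMastropietro2006, (2.36aa)] -/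
theorem hasDerivAt_uvShiftedSymbolFnD1 (hΛ₀ : 0 < Λ₀) (hθ : |θ| ≤ Λ₀ / 4) (ω : ℝ) :
    HasDerivAt (uvShiftedSymbolFnD1 c θ Λ₀ ξ) (uvShiftedSymbolFnD2 c θ Λ₀ ξ ω) ω := by
  by_cases h : Λ₀ ^ 2 / 5 < ω ^ 2 + ξ ^ 2
  · have hne := shiftDen_ne_zero_of_gt hθ h
    unfold uvShiftedSymbolFnD1 uvShiftedSymbolFnD2
    have hA := (hasDerivAt_uvWeightFnD1 Λ₀ ξ ω).ofReal_comp.mul (hasDerivAt_resolventFn (c := c) hne)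
    have hB := (hasDerivAt_uvWeightFn Λ₀ ξ ω).ofReal_comp.mul (hasDerivAt_resolventFnD1 (c := c) hne)
    refine (hA.add hB).congr_deriv ?_
    ring
  · have hlt : ω ^ 2 + ξ ^ 2 < Λ₀ ^ 2 / 4 := by linarith [not_lt.1 h, pow_pos hΛ₀ 2]
    have hopen : ∀ᶠ t in nhds ω, t ^ 2 + ξ ^ 2 < Λ₀ ^ 2 / 4 :=
      (continuous_pow 2 |>.add continuous_const).continuousAt.eventually_lt continuousAt_const hlt
    have hev : uvShiftedSymbolFnD1 c θ Λ₀ ξ =ᶠ[nhds ω] fun _ => (0 : ℂ) := by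
      filter_upwards [hopen] with t ht
      obtain ⟨h0, h1, -⟩ := uvWeightFn_eq_zero_of_lt hΛ₀ (e := ξ) (ω := t) ht
      rw [uvShiftedSymbolFnD1, h0, h1, Complex.ofReal_zero, zero_mul, zero_mul, add_zero]
    have hD2 : uvShiftedSymbolFnD2 c θ Λ₀ ξ ω = 0 := by
      obtain ⟨h0, h1, h2⟩ := uvWeightFn_eq_zero_of_lt hΛ₀ hlt
      rw [uvShiftedSymbolFnD2, h0, h1, h2, Complex.ofReal_zero]
      ring
    rw [hD2]
    exact (hasDerivAt_const ω (0 : ℂ)).congr_of_eventuallyEq hev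

/-- **Decay of the second frequency derivative**: `‖Ψ″(ω)‖ ≤ (32B₂+144B₁+200)·c/(Λ₀(ω²+ξ²+Λ₀²))` for `0 < Λ₀`, `|θ| ≤ Λ₀/4`,
`c ≥ 0`. [cite: BenfattoGiulianiMastropietro2006, App. A1] -/
theorem norm_uvShiftedSymbolFnD2_le (hΛ₀ : 0 < Λ₀) (hθ : |θ| ≤ Λ₀ / 4) (hc : 0 ≤ c) {B₁ B₂ : ℝ}
    (hB₁ : ∀ x, |deriv salmhoferCutoff x| ≤ B₁) (hB₂ : ∀ x, |deriv (deriv salmhoferCutoff) x| ≤ B₂) (ω : ℝ) :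
    ‖uvShiftedSymbolFnD2 c θ Λ₀ ξ ω‖ ≤ (32 * B₂ + 144 * B₁ + 200) * c / (Λ₀ * (ω ^ 2 + ξ ^ 2 + Λ₀ ^ 2)) := by
  have hB10 : 0 ≤ B₁ := (abs_nonneg _).trans (hB₁ 0)
  have hB20 : 0 ≤ B₂ := (abs_nonneg _).trans (hB₂ 0)
  set h : ℝ := ω ^ 2 + ξ ^ 2 with hh
  have hh0 : 0 ≤ h := by positivity
  by_cases hlow : h < Λ₀ ^ 2 / 4
  · obtain ⟨h0, h1, h2⟩ := uvWeightFn_eq_zero_of_lt hΛ₀ (e := ξ) (ω := ω) hlow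
    rw [uvShiftedSymbolFnD2, h0, h1, h2, Complex.ofReal_zero]
    simp only [zero_mul, mul_zero, add_zero, norm_zero]
    positivity
  rw [not_lt] at hlow
  -- the resolvent terms
  have hden2 := norm_sq_shiftDen_ge_of_ge hθ hlow
  set a := ‖-I * ((ω + θ : ℝ) : ℂ) + (ξ : ℂ)‖ with ha
  have ha_quarter : Λ₀ / 4 ≤ a := norm_shiftDen_ge hθ hlow
  have ha0 : 0 < a := lt_of_lt_of_le (by positivity) ha_quarter
  have ha5 : Λ₀ / 5 ≤ a := by linarith
  have hR2 : ‖resolventFnD2 c θ ξ ω‖ ≤ 200 * c / (Λ₀ * (h + Λ₀ ^ 2)) := by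
    rw [norm_resolventFnD2 hc, div_le_div_iff₀ (by positivity) (by positivity)]
    -- `a³ ≥ (Λ₀/5)·(h+Λ₀²)/20`
    have h3 : Λ₀ * (h + Λ₀ ^ 2) ≤ 100 * a ^ 3 := by
      have : Λ₀ / 5 * ((h + Λ₀ ^ 2) / 20) ≤ a * a ^ 2 := mul_le_mul ha5 hden2 (by positivity) ha0.le
      nlinarith
    nlinarith
  -- the cutoff terms live where `h ≤ Λ₀²` (else `W′ = W″ = 0`)
  have hW : ‖(uvWeightFn Λ₀ ξ ω : ℂ)‖ ≤ 1 := by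
    rw [Complex.norm_real, Real.norm_eq_abs]; exact abs_uvWeightFn_le_one Λ₀ ξ ω
  have hmid : ‖(uvWeightFnD2 Λ₀ ξ ω : ℂ) * resolventFn c θ ξ ω‖ + ‖2 * ((uvWeightFnD1 Λ₀ ξ ω : ℂ) * resolventFnD1 c θ ξ ω)‖ ≤
      (32 * B₂ + 144 * B₁) * c / (Λ₀ * (h + Λ₀ ^ 2)) := by
    by_cases hhigh : Λ₀ ^ 2 < h
    · obtain ⟨-, h1, h2⟩ := uvWeightFn_eq_one_of_gt hΛ₀ (e := ξ) (ω := ω) hhigh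
      rw [h1, h2, Complex.ofReal_zero]
      simp only [zero_mul, mul_zero, norm_zero, add_zero]
      positivity
    · rw [not_lt] at hhigh
      have hR : ‖resolventFn c θ ξ ω‖ ≤ 4 * c / Λ₀ := by
        rw [norm_resolventFn hc, div_le_div_iff₀ ha0 hΛ₀]; nlinarith
      have hR1 : ‖resolventFnD1 c θ ξ ω‖ ≤ 16 * c / Λ₀ ^ 2 := by
        rw [norm_resolventFnD1 hc, div_le_div_iff₀ (by positivity) (by positivity)]
        have : Λ₀ ^ 2 ≤ 16 * a ^ 2 := by nlinarith
        nlinarith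
      have hW1 : ‖(uvWeightFnD1 Λ₀ ξ ω : ℂ)‖ ≤ 2 * B₁ / Λ₀ := by
        rw [Complex.norm_real, Real.norm_eq_abs]; exact abs_uvWeightFnD1_le hB₁ hΛ₀ ξ ω
      have hW2 : ‖(uvWeightFnD2 Λ₀ ξ ω : ℂ)‖ ≤ (4 * B₂ + 2 * B₁) / Λ₀ ^ 2 := by
        rw [Complex.norm_real, Real.norm_eq_abs]; exact abs_uvWeightFnD2_le hB₁ hB₂ hΛ₀ ξ ω
      have hsum : ‖(uvWeightFnD2 Λ₀ ξ ω : ℂ) * resolventFn c θ ξ ω‖ + ‖2 * ((uvWeightFnD1 Λ₀ ξ ω : ℂ) * resolventFnD1 c θ ξ ω)‖ ≤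
          (4 * B₂ + 2 * B₁) / Λ₀ ^ 2 * (4 * c / Λ₀) + 2 * (2 * B₁ / Λ₀ * (16 * c / Λ₀ ^ 2)) := by
        refine add_le_add ?_ ?_
        · rw [norm_mul]; exact mul_le_mul hW2 hR (norm_nonneg _) (by positivity)
        · rw [norm_mul, norm_mul, Complex.norm_ofNat]
          exact mul_le_mul_of_nonneg_left (mul_le_mul hW1 hR1 (norm_nonneg _) (by positivity)) (by norm_num)
      refine hsum.trans ?_
      rw [show (4 * B₂ + 2 * B₁) / Λ₀ ^ 2 * (4 * c / Λ₀) + 2 * (2 * B₁ / Λ₀ * (16 * c / Λ₀ ^ 2)) =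
          (16 * B₂ + 72 * B₁) * c / Λ₀ ^ 3 by field_simp; ring]
      rw [div_le_div_iff₀ (by positivity) (by positivity)]
      have : h + Λ₀ ^ 2 ≤ 2 * Λ₀ ^ 2 := by linarith
      have hc' : 0 ≤ (16 * B₂ + 72 * B₁) * c := by positivity
      nlinarith [mul_le_mul_of_nonneg_left this hc', pow_pos hΛ₀ 3]
  rw [uvShiftedSymbolFnD2]
  calc _ ≤ ‖(uvWeightFnD2 Λ₀ ξ ω : ℂ) * resolventFn c θ ξ ω‖ + ‖2 * ((uvWeightFnD1 Λ₀ ξ ω : ℂ) * resolventFnD1 c θ ξ ω)‖ +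
        ‖(uvWeightFn Λ₀ ξ ω : ℂ) * resolventFnD2 c θ ξ ω‖ := norm_add₃_le
    _ ≤ (32 * B₂ + 144 * B₁) * c / (Λ₀ * (h + Λ₀ ^ 2)) + 1 * (200 * c / (Λ₀ * (h + Λ₀ ^ 2))) := by
        refine add_le_add hmid ?_
        rw [norm_mul]; exact mul_le_mul hW hR2 (norm_nonneg _) zero_le_one
    _ = (32 * B₂ + 144 * B₁ + 200) * c / (Λ₀ * (ω ^ 2 + ξ ^ 2 + Λ₀ ^ 2)) := by rw [hh]; ring

/-- **Decay of the symbol itself**: `‖Ψ(ω)‖² ≤ 20c²/(ω²+ξ²+Λ₀²)`. [cite: BenfattoGiulianiMastropietro2006, App. A1] -/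
theorem norm_sq_uvShiftedSymbolFn_le (hΛ₀ : 0 < Λ₀) (hθ : |θ| ≤ Λ₀ / 4) (hc : 0 ≤ c) (ω : ℝ) :
    ‖uvShiftedSymbolFn c θ Λ₀ ξ ω‖ ^ 2 ≤ 20 * c ^ 2 / (ω ^ 2 + ξ ^ 2 + Λ₀ ^ 2) := by
  by_cases hlow : ω ^ 2 + ξ ^ 2 < Λ₀ ^ 2 / 4
  · rw [uvShiftedSymbolFn, (uvWeightFn_eq_zero_of_lt hΛ₀ hlow).1, Complex.ofReal_zero, zero_mul, norm_zero, zero_pow two_ne_zero]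
    positivity
  rw [not_lt] at hlow
  have hden2 := norm_sq_shiftDen_ge_of_ge hθ hlow
  have ha0 : 0 < ‖-I * ((ω + θ : ℝ) : ℂ) + (ξ : ℂ)‖ := lt_of_lt_of_le (by positivity) (norm_shiftDen_ge hθ hlow)
  rw [uvShiftedSymbolFn, norm_mul, mul_pow, norm_resolventFn hc, div_pow]
  have hW : ‖(uvWeightFn Λ₀ ξ ω : ℂ)‖ ^ 2 ≤ 1 := by
    rw [Complex.norm_real, Real.norm_eq_abs, sq_abs]
    have := abs_uvWeightFn_le_one Λ₀ ξ ω
    rw [abs_le] at this; nlinarith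
  calc ‖(uvWeightFn Λ₀ ξ ω : ℂ)‖ ^ 2 * (c ^ 2 / ‖-I * ((ω + θ : ℝ) : ℂ) + (ξ : ℂ)‖ ^ 2)
      ≤ 1 * (c ^ 2 / ‖-I * ((ω + θ : ℝ) : ℂ) + (ξ : ℂ)‖ ^ 2) := mul_le_mul_of_nonneg_right hW (by positivity)
    _ ≤ 20 * c ^ 2 / (ω ^ 2 + ξ ^ 2 + Λ₀ ^ 2) := by
        rw [one_mul, div_le_div_iff₀ (by positivity) (by positivity)]; nlinarith [sq_nonneg c]

end Freq

/-! ### The UV symbol as a function of the band variable `ξ` -/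

/-- `Ψ̂(ξ) = W(ξ) R̂(ξ)` with the same (symmetric) weight and `R̂ = c/(-i(ω+θ)+ξ)` differentiated in `ξ`.
[cite: BenfattoGiulianiMastropietro2006, §2.2 (2.10)] -/
def uvShiftedSymbolFnXi (c θ Λ₀ ω ξ : ℝ) : ℂ := (uvWeightFn Λ₀ ω ξ : ℂ) * resolventFnXi c θ ω ξ

/-- `Ψ̂′`. [cite: BenfattoGiulianiMastropietro2006, §2.2 (2.10)] -/
def uvShiftedSymbolFnXiD1 (c θ Λ₀ ω ξ : ℝ) : ℂ :=
  (uvWeightFnD1 Λ₀ ω ξ : ℂ) * resolventFnXi c θ ω ξ + (uvWeightFn Λ₀ ω ξ : ℂ) * resolventFnXiD1 c θ ω ξ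

/-- `Ψ̂″`. [cite: BenfattoGiulianiMastropietro2006, §2.2 (2.10)] -/
def uvShiftedSymbolFnXiD2 (c θ Λ₀ ω ξ : ℝ) : ℂ :=
  (uvWeightFnD2 Λ₀ ω ξ : ℂ) * resolventFnXi c θ ω ξ + 2 * ((uvWeightFnD1 Λ₀ ω ξ : ℂ) * resolventFnXiD1 c θ ω ξ) +
    (uvWeightFn Λ₀ ω ξ : ℂ) * resolventFnXiD2 c θ ω ξ

/-- `Ψ_ξ(ω) = Ψ̂_ω(ξ)`. [cite: BenfattoGiulianiMastropietro2006, §2.2 (2.10)] -/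
theorem uvShiftedSymbolFn_eq_uvShiftedSymbolFnXi (c θ Λ₀ ξ ω : ℝ) : uvShiftedSymbolFn c θ Λ₀ ξ ω = uvShiftedSymbolFnXi c θ Λ₀ ω ξ := by
  simp only [uvShiftedSymbolFn, uvShiftedSymbolFnXi, uvWeightFn, resolventFn, resolventFnXi, add_comm (ω ^ 2) (ξ ^ 2)]

section Xi

variable {c θ Λ₀ ω : ℝ}

/-- **`Ψ̂` is differentiable in `ξ` everywhere.** [cite: BenfattoGiulianiMastropietro2006, (2.36aa)] -/
theorem hasDerivAt_uvShiftedSymbolFnXi (hΛ₀ : 0 < Λ₀) (hθ : |θ| ≤ Λ₀ / 4) (ξ : ℝ) :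
    HasDerivAt (uvShiftedSymbolFnXi c θ Λ₀ ω) (uvShiftedSymbolFnXiD1 c θ Λ₀ ω ξ) ξ := by
  by_cases h : Λ₀ ^ 2 / 5 < ξ ^ 2 + ω ^ 2
  · unfold uvShiftedSymbolFnXi uvShiftedSymbolFnXiD1
    exact (hasDerivAt_uvWeightFn Λ₀ ω ξ).ofReal_comp.mul (hasDerivAt_resolventFnXi (shiftDen_ne_zero_of_gt_xi hθ h))
  · have hlt : ξ ^ 2 + ω ^ 2 < Λ₀ ^ 2 / 4 := by linarith [not_lt.1 h, pow_pos hΛ₀ 2]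
    have hopen : ∀ᶠ t in nhds ξ, t ^ 2 + ω ^ 2 < Λ₀ ^ 2 / 4 :=
      (continuous_pow 2 |>.add continuous_const).continuousAt.eventually_lt continuousAt_const hlt
    have hev : uvShiftedSymbolFnXi c θ Λ₀ ω =ᶠ[nhds ξ] fun _ => (0 : ℂ) := by
      filter_upwards [hopen] with t ht
      rw [uvShiftedSymbolFnXi, (uvWeightFn_eq_zero_of_lt hΛ₀ ht).1, Complex.ofReal_zero, zero_mul]
    have hD1 : uvShiftedSymbolFnXiD1 c θ Λ₀ ω ξ = 0 := by
      obtain ⟨h0, h1, -⟩ := uvWeightFn_eq_zero_of_lt hΛ₀ (e := ω) (ω := ξ) hlt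
      rw [uvShiftedSymbolFnXiD1, h0, h1, Complex.ofReal_zero, zero_mul, zero_mul, add_zero]
    rw [hD1]
    exact (hasDerivAt_const ξ (0 : ℂ)).congr_of_eventuallyEq hev

/-- **`Ψ̂′` is differentiable in `ξ` everywhere.** [cite: BenfattoGiulianiMastropietro2006, (2.36aa)] -/
theorem hasDerivAt_uvShiftedSymbolFnXiD1 (hΛ₀ : 0 < Λ₀) (hθ : |θ| ≤ Λ₀ / 4) (ξ : ℝ) :
    HasDerivAt (uvShiftedSymbolFnXiD1 c θ Λ₀ ω) (uvShiftedSymbolFnXiD2 c θ Λ₀ ω ξ) ξ := by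
  by_cases h : Λ₀ ^ 2 / 5 < ξ ^ 2 + ω ^ 2
  · have hne := shiftDen_ne_zero_of_gt_xi hθ h
    unfold uvShiftedSymbolFnXiD1 uvShiftedSymbolFnXiD2
    have hA := (hasDerivAt_uvWeightFnD1 Λ₀ ω ξ).ofReal_comp.mul (hasDerivAt_resolventFnXi (c := c) hne)
    have hB := (hasDerivAt_uvWeightFn Λ₀ ω ξ).ofReal_comp.mul (hasDerivAt_resolventFnXiD1 (c := c) hne)
    refine (hA.add hB).congr_deriv ?_
    ring
  · have hlt : ξ ^ 2 + ω ^ 2 < Λ₀ ^ 2 / 4 := by linarith [not_lt.1 h, pow_pos hΛ₀ 2]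
    have hopen : ∀ᶠ t in nhds ξ, t ^ 2 + ω ^ 2 < Λ₀ ^ 2 / 4 :=
      (continuous_pow 2 |>.add continuous_const).continuousAt.eventually_lt continuousAt_const hlt
    have hev : uvShiftedSymbolFnXiD1 c θ Λ₀ ω =ᶠ[nhds ξ] fun _ => (0 : ℂ) := by
      filter_upwards [hopen] with t ht
      obtain ⟨h0, h1, -⟩ := uvWeightFn_eq_zero_of_lt hΛ₀ (e := ω) (ω := t) ht
      rw [uvShiftedSymbolFnXiD1, h0, h1, Complex.ofReal_zero, zero_mul, zero_mul, add_zero]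
    have hD2 : uvShiftedSymbolFnXiD2 c θ Λ₀ ω ξ = 0 := by
      obtain ⟨h0, h1, h2⟩ := uvWeightFn_eq_zero_of_lt hΛ₀ (e := ω) (ω := ξ) hlt
      rw [uvShiftedSymbolFnXiD2, h0, h1, h2, Complex.ofReal_zero]
      ring
    rw [hD2]
    exact (hasDerivAt_const ξ (0 : ℂ)).congr_of_eventuallyEq hev

/-- **`‖Ψ̂′(ξ)‖ ≤ (16B₁ + 20)·c/(ω²+ξ²+Λ₀²)`** (`0 < Λ₀`, `|θ| ≤ Λ₀/4`, `c ≥ 0`). [cite: BenfattoGiulianiMastropietro2006, App. A1] -/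
theorem norm_uvShiftedSymbolFnXiD1_le (hΛ₀ : 0 < Λ₀) (hθ : |θ| ≤ Λ₀ / 4) (hc : 0 ≤ c) {B₁ : ℝ}
    (hB₁ : ∀ x, |deriv salmhoferCutoff x| ≤ B₁) (ξ : ℝ) :
    ‖uvShiftedSymbolFnXiD1 c θ Λ₀ ω ξ‖ ≤ (16 * B₁ + 20) * c / (ω ^ 2 + ξ ^ 2 + Λ₀ ^ 2) := by
  have hB10 : 0 ≤ B₁ := (abs_nonneg _).trans (hB₁ 0)
  set h : ℝ := ω ^ 2 + ξ ^ 2 with hh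
  by_cases hlow : ξ ^ 2 + ω ^ 2 < Λ₀ ^ 2 / 4
  · obtain ⟨h0, h1, -⟩ := uvWeightFn_eq_zero_of_lt hΛ₀ (e := ω) (ω := ξ) hlow
    rw [uvShiftedSymbolFnXiD1, h0, h1, Complex.ofReal_zero]
    simp only [zero_mul, add_zero, norm_zero]
    positivity
  rw [not_lt] at hlow
  have hlow' : Λ₀ ^ 2 / 4 ≤ ω ^ 2 + ξ ^ 2 := by linarith
  have hden2 := norm_sq_shiftDen_ge_of_ge hθ hlow'
  set a := ‖-I * ((ω + θ : ℝ) : ℂ) + (ξ : ℂ)‖ with ha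
  have ha0 : 0 < a := lt_of_lt_of_le (by positivity) (norm_shiftDen_ge hθ hlow')
  have hR1 : ‖resolventFnXiD1 c θ ω ξ‖ ≤ 20 * c / (h + Λ₀ ^ 2) := by
    rw [norm_resolventFnXiD1 hc, div_le_div_iff₀ (by positivity) (by positivity)]; nlinarith
  have hW : ‖(uvWeightFn Λ₀ ω ξ : ℂ)‖ ≤ 1 := by
    rw [Complex.norm_real, Real.norm_eq_abs]; exact abs_uvWeightFn_le_one Λ₀ ω ξ
  have hfirst : ‖(uvWeightFnD1 Λ₀ ω ξ : ℂ) * resolventFnXi c θ ω ξ‖ ≤ 16 * B₁ * c / (h + Λ₀ ^ 2) := by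
    by_cases hhigh : Λ₀ ^ 2 < ξ ^ 2 + ω ^ 2
    · obtain ⟨-, h1, -⟩ := uvWeightFn_eq_one_of_gt hΛ₀ (e := ω) (ω := ξ) hhigh
      rw [h1, Complex.ofReal_zero, zero_mul, norm_zero]; positivity
    · rw [not_lt] at hhigh
      have hR : ‖resolventFnXi c θ ω ξ‖ ≤ 4 * c / Λ₀ := by
        rw [norm_resolventFnXi hc, div_le_div_iff₀ ha0 hΛ₀]; nlinarith [norm_shiftDen_ge hθ hlow']
      have hW1 : ‖(uvWeightFnD1 Λ₀ ω ξ : ℂ)‖ ≤ 2 * B₁ / Λ₀ := by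
        rw [Complex.norm_real, Real.norm_eq_abs]; exact abs_uvWeightFnD1_le hB₁ hΛ₀ ω ξ
      rw [norm_mul]
      refine (mul_le_mul hW1 hR (norm_nonneg _) (by positivity)).trans ?_
      rw [show 2 * B₁ / Λ₀ * (4 * c / Λ₀) = 8 * B₁ * c / Λ₀ ^ 2 by field_simp; ring,
        div_le_div_iff₀ (by positivity) (by positivity)]
      have : h + Λ₀ ^ 2 ≤ 2 * Λ₀ ^ 2 := by linarith
      have hc' : 0 ≤ 8 * B₁ * c := by positivity
      nlinarith [mul_le_mul_of_nonneg_left this hc']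
  rw [uvShiftedSymbolFnXiD1]
  calc _ ≤ ‖(uvWeightFnD1 Λ₀ ω ξ : ℂ) * resolventFnXi c θ ω ξ‖ + ‖(uvWeightFn Λ₀ ω ξ : ℂ) * resolventFnXiD1 c θ ω ξ‖ := norm_add_le _ _
    _ ≤ 16 * B₁ * c / (h + Λ₀ ^ 2) + 1 * (20 * c / (h + Λ₀ ^ 2)) := by
        refine add_le_add hfirst ?_
        rw [norm_mul]; exact mul_le_mul hW hR1 (norm_nonneg _) zero_le_one
    _ = (16 * B₁ + 20) * c / (ω ^ 2 + ξ ^ 2 + Λ₀ ^ 2) := by rw [hh]; ring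

/-- **`‖Ψ̂″(ξ)‖ ≤ (32B₂+144B₁+200)·c/(Λ₀(ω²+ξ²+Λ₀²))`.** [cite: BenfattoGiulianiMastropietro2006, App. A1] -/
theorem norm_uvShiftedSymbolFnXiD2_le (hΛ₀ : 0 < Λ₀) (hθ : |θ| ≤ Λ₀ / 4) (hc : 0 ≤ c) {B₁ B₂ : ℝ}
    (hB₁ : ∀ x, |deriv salmhoferCutoff x| ≤ B₁) (hB₂ : ∀ x, |deriv (deriv salmhoferCutoff) x| ≤ B₂) (ξ : ℝ) :
    ‖uvShiftedSymbolFnXiD2 c θ Λ₀ ω ξ‖ ≤ (32 * B₂ + 144 * B₁ + 200) * c / (Λ₀ * (ω ^ 2 + ξ ^ 2 + Λ₀ ^ 2)) := by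
  have hB10 : 0 ≤ B₁ := (abs_nonneg _).trans (hB₁ 0)
  have hB20 : 0 ≤ B₂ := (abs_nonneg _).trans (hB₂ 0)
  set h : ℝ := ω ^ 2 + ξ ^ 2 with hh
  by_cases hlow : ξ ^ 2 + ω ^ 2 < Λ₀ ^ 2 / 4
  · obtain ⟨h0, h1, h2⟩ := uvWeightFn_eq_zero_of_lt hΛ₀ (e := ω) (ω := ξ) hlow
    rw [uvShiftedSymbolFnXiD2, h0, h1, h2, Complex.ofReal_zero]
    simp only [zero_mul, mul_zero, add_zero, norm_zero]
    positivity
  rw [not_lt] at hlow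
  have hlow' : Λ₀ ^ 2 / 4 ≤ ω ^ 2 + ξ ^ 2 := by linarith
  have hden2 := norm_sq_shiftDen_ge_of_ge hθ hlow'
  set a := ‖-I * ((ω + θ : ℝ) : ℂ) + (ξ : ℂ)‖ with ha
  have ha_quarter : Λ₀ / 4 ≤ a := norm_shiftDen_ge hθ hlow'
  have ha0 : 0 < a := lt_of_lt_of_le (by positivity) ha_quarter
  have ha5 : Λ₀ / 5 ≤ a := by linarith
  have hR2 : ‖resolventFnXiD2 c θ ω ξ‖ ≤ 200 * c / (Λ₀ * (h + Λ₀ ^ 2)) := by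
    rw [norm_resolventFnXiD2 hc, div_le_div_iff₀ (by positivity) (by positivity)]
    have h3 : Λ₀ * (h + Λ₀ ^ 2) ≤ 100 * a ^ 3 := by
      have : Λ₀ / 5 * ((h + Λ₀ ^ 2) / 20) ≤ a * a ^ 2 := mul_le_mul ha5 hden2 (by positivity) ha0.le
      nlinarith
    nlinarith
  have hW : ‖(uvWeightFn Λ₀ ω ξ : ℂ)‖ ≤ 1 := by
    rw [Complex.norm_real, Real.norm_eq_abs]; exact abs_uvWeightFn_le_one Λ₀ ω ξ
  have hmid : ‖(uvWeightFnD2 Λ₀ ω ξ : ℂ) * resolventFnXi c θ ω ξ‖ + ‖2 * ((uvWeightFnD1 Λ₀ ω ξ : ℂ) * resolventFnXiD1 c θ ω ξ)‖ ≤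
      (32 * B₂ + 144 * B₁) * c / (Λ₀ * (h + Λ₀ ^ 2)) := by
    by_cases hhigh : Λ₀ ^ 2 < ξ ^ 2 + ω ^ 2
    · obtain ⟨-, h1, h2⟩ := uvWeightFn_eq_one_of_gt hΛ₀ (e := ω) (ω := ξ) hhigh
      rw [h1, h2, Complex.ofReal_zero]
      simp only [zero_mul, mul_zero, norm_zero, add_zero]
      positivity
    · rw [not_lt] at hhigh
      have hR : ‖resolventFnXi c θ ω ξ‖ ≤ 4 * c / Λ₀ := by
        rw [norm_resolventFnXi hc, div_le_div_iff₀ ha0 hΛ₀]; nlinarith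
      have hR1 : ‖resolventFnXiD1 c θ ω ξ‖ ≤ 16 * c / Λ₀ ^ 2 := by
        rw [norm_resolventFnXiD1 hc, div_le_div_iff₀ (by positivity) (by positivity)]
        have : Λ₀ ^ 2 ≤ 16 * a ^ 2 := by nlinarith
        nlinarith
      have hW1 : ‖(uvWeightFnD1 Λ₀ ω ξ : ℂ)‖ ≤ 2 * B₁ / Λ₀ := by
        rw [Complex.norm_real, Real.norm_eq_abs]; exact abs_uvWeightFnD1_le hB₁ hΛ₀ ω ξ
      have hW2 : ‖(uvWeightFnD2 Λ₀ ω ξ : ℂ)‖ ≤ (4 * B₂ + 2 * B₁) / Λ₀ ^ 2 := by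
        rw [Complex.norm_real, Real.norm_eq_abs]; exact abs_uvWeightFnD2_le hB₁ hB₂ hΛ₀ ω ξ
      have hsum : ‖(uvWeightFnD2 Λ₀ ω ξ : ℂ) * resolventFnXi c θ ω ξ‖ + ‖2 * ((uvWeightFnD1 Λ₀ ω ξ : ℂ) * resolventFnXiD1 c θ ω ξ)‖ ≤
          (4 * B₂ + 2 * B₁) / Λ₀ ^ 2 * (4 * c / Λ₀) + 2 * (2 * B₁ / Λ₀ * (16 * c / Λ₀ ^ 2)) := by
        refine add_le_add ?_ ?_
        · rw [norm_mul]; exact mul_le_mul hW2 hR (norm_nonneg _) (by positivity)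
        · rw [norm_mul, norm_mul, Complex.norm_ofNat]
          exact mul_le_mul_of_nonneg_left (mul_le_mul hW1 hR1 (norm_nonneg _) (by positivity)) (by norm_num)
      refine hsum.trans ?_
      rw [show (4 * B₂ + 2 * B₁) / Λ₀ ^ 2 * (4 * c / Λ₀) + 2 * (2 * B₁ / Λ₀ * (16 * c / Λ₀ ^ 2)) =
          (16 * B₂ + 72 * B₁) * c / Λ₀ ^ 3 by field_simp; ring]
      rw [div_le_div_iff₀ (by positivity) (by positivity)]
      have : h + Λ₀ ^ 2 ≤ 2 * Λ₀ ^ 2 := by linarith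
      have hc' : 0 ≤ (16 * B₂ + 72 * B₁) * c := by positivity
      nlinarith [mul_le_mul_of_nonneg_left this hc', pow_pos hΛ₀ 3]
  rw [uvShiftedSymbolFnXiD2]
  calc _ ≤ ‖(uvWeightFnD2 Λ₀ ω ξ : ℂ) * resolventFnXi c θ ω ξ‖ + ‖2 * ((uvWeightFnD1 Λ₀ ω ξ : ℂ) * resolventFnXiD1 c θ ω ξ)‖ +
        ‖(uvWeightFn Λ₀ ω ξ : ℂ) * resolventFnXiD2 c θ ω ξ‖ := norm_add₃_le
    _ ≤ (32 * B₂ + 144 * B₁) * c / (Λ₀ * (h + Λ₀ ^ 2)) + 1 * (200 * c / (Λ₀ * (h + Λ₀ ^ 2))) := by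
        refine add_le_add hmid ?_
        rw [norm_mul]; exact mul_le_mul hW hR2 (norm_nonneg _) zero_le_one
    _ = (32 * B₂ + 144 * B₁ + 200) * c / (Λ₀ * (ω ^ 2 + ξ ^ 2 + Λ₀ ^ 2)) := by rw [hh]; ring

end Xi

/-! ### The UV symbol as a function of one momentum component -/

/-- `Φ(p) = Ψ̂_ω(ξ(p))`, `ξ(p) = -2cos p + e₀`. [cite: BenfattoGiulianiMastropietro2006, §2.2 (2.10)] -/
def uvShiftedMomentumSymbolFn (c θ Λ₀ ω e₀ p : ℝ) : ℂ := uvShiftedSymbolFnXi c θ Λ₀ ω (bandFn e₀ p)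

/-- `Φ′(p) = ξ′(p) Ψ̂′(ξ(p))`. [cite: BenfattoGiulianiMastropietro2006, §2.2 (2.10)] -/
def uvShiftedMomentumSymbolFnD1 (c θ Λ₀ ω e₀ p : ℝ) : ℂ := ((2 * Real.sin p : ℝ) : ℂ) * uvShiftedSymbolFnXiD1 c θ Λ₀ ω (bandFn e₀ p)

/-- `Φ″(p) = ξ′² Ψ̂″ + ξ″ Ψ̂′`. [cite: BenfattoGiulianiMastropietro2006, §2.2 (2.10)] -/
def uvShiftedMomentumSymbolFnD2 (c θ Λ₀ ω e₀ p : ℝ) : ℂ :=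
  ((2 * Real.sin p : ℝ) : ℂ) * (((2 * Real.sin p : ℝ) : ℂ) * uvShiftedSymbolFnXiD2 c θ Λ₀ ω (bandFn e₀ p)) +
    ((2 * Real.cos p : ℝ) : ℂ) * uvShiftedSymbolFnXiD1 c θ Λ₀ ω (bandFn e₀ p)

section Momentum

variable {c θ Λ₀ ω e₀ : ℝ}

/-- **`Φ` is differentiable.** [cite: BenfattoGiulianiMastropietro2006, (2.36aa)] -/
theorem hasDerivAt_uvShiftedMomentumSymbolFn (hΛ₀ : 0 < Λ₀) (hθ : |θ| ≤ Λ₀ / 4) (p : ℝ) :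
    HasDerivAt (uvShiftedMomentumSymbolFn c θ Λ₀ ω e₀) (uvShiftedMomentumSymbolFnD1 c θ Λ₀ ω e₀ p) p := by
  unfold uvShiftedMomentumSymbolFn uvShiftedMomentumSymbolFnD1
  have h := (hasDerivAt_uvShiftedSymbolFnXi (c := c) (ω := ω) hΛ₀ hθ (bandFn e₀ p)).scomp p (hasDerivAt_bandFn e₀ p)
  refine h.congr_deriv ?_
  rw [Complex.real_smul]

/-- **`Φ′` is differentiable.** [cite: BenfattoGiulianiMastropietro2006, (2.36aa)] -/
theorem hasDerivAt_uvShiftedMomentumSymbolFnD1 (hΛ₀ : 0 < Λ₀) (hθ : |θ| ≤ Λ₀ / 4) (p : ℝ) :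
    HasDerivAt (uvShiftedMomentumSymbolFnD1 c θ Λ₀ ω e₀) (uvShiftedMomentumSymbolFnD2 c θ Λ₀ ω e₀ p) p := by
  unfold uvShiftedMomentumSymbolFnD1 uvShiftedMomentumSymbolFnD2
  have h1 := (hasDerivAt_uvShiftedSymbolFnXiD1 (c := c) (ω := ω) hΛ₀ hθ (bandFn e₀ p)).scomp p (hasDerivAt_bandFn e₀ p)
  have h2 := (hasDerivAt_two_sin p).ofReal_comp
  refine (h2.mul h1).congr_deriv ?_
  rw [Complex.real_smul]
  simp only [Function.comp_apply]
  push_cast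
  ring

/-- **Decay of the second momentum derivative**: `‖Φ″(p)‖ ≤ (4K + 32B₁ + 40)·c/(Λ₀(ω²+ξ(p)²+Λ₀²))`, `K = 32B₂+144B₁+200`, for
`0 < Λ₀ ≤ 1`, `|θ| ≤ Λ₀/4`, `c ≥ 0`. [cite: BenfattoGiulianiMastropietro2006, App. A1] -/
theorem norm_uvShiftedMomentumSymbolFnD2_le (hΛ₀ : 0 < Λ₀) (hΛ₀1 : Λ₀ ≤ 1) (hθ : |θ| ≤ Λ₀ / 4) (hc : 0 ≤ c) {B₁ B₂ : ℝ}
    (hB₁ : ∀ x, |deriv salmhoferCutoff x| ≤ B₁) (hB₂ : ∀ x, |deriv (deriv salmhoferCutoff) x| ≤ B₂) (p : ℝ) :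
    ‖uvShiftedMomentumSymbolFnD2 c θ Λ₀ ω e₀ p‖ ≤
      (4 * (32 * B₂ + 144 * B₁ + 200) + 32 * B₁ + 40) * c / (Λ₀ * (ω ^ 2 + bandFn e₀ p ^ 2 + Λ₀ ^ 2)) := by
  have hB10 : 0 ≤ B₁ := (abs_nonneg _).trans (hB₁ 0)
  have hB20 : 0 ≤ B₂ := (abs_nonneg _).trans (hB₂ 0)
  set h : ℝ := ω ^ 2 + bandFn e₀ p ^ 2 with hh
  have hh0 : 0 ≤ h := by positivity
  have hs : ‖((2 * Real.sin p : ℝ) : ℂ)‖ ≤ 2 := by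
    rw [Complex.norm_real, Real.norm_eq_abs, abs_mul, abs_of_pos (by norm_num : (0:ℝ) < 2)]
    linarith [Real.abs_sin_le_one p]
  have hco : ‖((2 * Real.cos p : ℝ) : ℂ)‖ ≤ 2 := by
    rw [Complex.norm_real, Real.norm_eq_abs, abs_mul, abs_of_pos (by norm_num : (0:ℝ) < 2)]
    linarith [Real.abs_cos_le_one p]
  have h2 := norm_uvShiftedSymbolFnXiD2_le (c := c) (ω := ω) hΛ₀ hθ hc hB₁ hB₂ (bandFn e₀ p)
  have h1 := norm_uvShiftedSymbolFnXiD1_le (c := c) (ω := ω) hΛ₀ hθ hc hB₁ (bandFn e₀ p)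
  rw [← hh] at h1 h2
  have h1' : ‖uvShiftedSymbolFnXiD1 c θ Λ₀ ω (bandFn e₀ p)‖ ≤ (16 * B₁ + 20) * c / (Λ₀ * (h + Λ₀ ^ 2)) := by
    refine h1.trans ?_
    rw [div_le_div_iff₀ (by positivity) (by positivity)]
    have : Λ₀ * (h + Λ₀ ^ 2) ≤ h + Λ₀ ^ 2 := by nlinarith
    nlinarith [mul_le_mul_of_nonneg_left this (by positivity : 0 ≤ (16 * B₁ + 20) * c)]
  rw [uvShiftedMomentumSymbolFnD2]
  calc _ ≤ ‖((2 * Real.sin p : ℝ) : ℂ) * (((2 * Real.sin p : ℝ) : ℂ) * uvShiftedSymbolFnXiD2 c θ Λ₀ ω (bandFn e₀ p))‖ +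
        ‖((2 * Real.cos p : ℝ) : ℂ) * uvShiftedSymbolFnXiD1 c θ Λ₀ ω (bandFn e₀ p)‖ := norm_add_le _ _
    _ ≤ 2 * (2 * ((32 * B₂ + 144 * B₁ + 200) * c / (Λ₀ * (h + Λ₀ ^ 2)))) + 2 * ((16 * B₁ + 20) * c / (Λ₀ * (h + Λ₀ ^ 2))) := by
        refine add_le_add ?_ ?_
        · rw [norm_mul, norm_mul]
          exact mul_le_mul hs (mul_le_mul hs h2 (norm_nonneg _) (by norm_num)) (by positivity) (by norm_num)
        · rw [norm_mul]
          exact mul_le_mul hco h1' (norm_nonneg _) (by norm_num)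
    _ = (4 * (32 * B₂ + 144 * B₁ + 200) + 32 * B₁ + 40) * c / (Λ₀ * (ω ^ 2 + bandFn e₀ p ^ 2 + Λ₀ ^ 2)) := by rw [hh]; ring

end Momentum

/-! ### The lattice symbol is the restriction -/

/-- **The UV symbol at a Matsubara frequency**: `w_{Λ₀}(k)·p_θ(k,σ) = Ψ_{ξ(k⃗)}(ω_i)`, `c = βL²` (`0 < β`, `|βθ| ≤ π/4`).
[cite: BenfattoGiulianiMastropietro2006, §2.2 (2.10)] -/
theorem uvShiftedSymbol_eq_uvShiftedSymbolFn {L M : ℕ} [NeZero L] {β : ℝ} (hβ : 0 < β) (μ : ℝ) {θ : ℝ} (hθ : |β * θ| ≤ Real.pi / 4)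
    (Λ₀ : ℝ) (i : MatsubaraIdx M) (kv : TorusSite 2 L) (σ : Fin 2) :
    ((hubbardCutoffWeight L M β μ Λ₀ (i, kv) : ℝ) : ℂ) * shiftedFreeSymbol L M β μ θ ((i, kv), σ) =
      uvShiftedSymbolFn (β * (L : ℝ) ^ 2) θ Λ₀ (nambuXi L μ kv) (matsubaraFreq β M i) := by
  rw [uvShiftedSymbolFn, uvWeightFn, resolventFn, hubbardCutoffWeight]
  have hden : (matsubaraFreq β M i + θ) ^ 2 + nambuXi L μ kv ^ 2 ≠ 0 := by
    intro h0
    -- denominators of Matsubara labels never vanish (`|ω| ≥ π/β > |θ|`)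
    have hω := pi_div_le_abs_matsubaraFreq hβ i
    have h1 : matsubaraFreq β M i + θ = 0 := by nlinarith [sq_nonneg (matsubaraFreq β M i + θ), sq_nonneg (nambuXi L μ kv)]
    have h2 : β * |matsubaraFreq β M i| ≥ Real.pi := by
      have := mul_le_mul_of_nonneg_left hω hβ.le
      rwa [mul_div_cancel₀ _ hβ.ne'] at this
    have h3 : |β * θ| = β * |matsubaraFreq β M i| := by
      rw [show θ = -matsubaraFreq β M i by linarith, mul_neg, abs_neg, abs_mul, abs_of_pos hβ]
    linarith [Real.pi_pos]
  rw [shiftedFreeSymbol_eq_div β μ θ ((i, kv), σ) hden]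

/-- **The UV symbol along a momentum shift**: at `k⃗ + m·e_j` it is `Φ` at `p_j + m·2π/L` (`e₀ = ξ(k⃗) + 2cos p_j`).
[cite: BenfattoGiulianiMastropietro2006, §2.2 (2.10)] -/
theorem uvShiftedSymbol_shift_eq_uvShiftedMomentumSymbolFn {L M : ℕ} [NeZero L] {β : ℝ} (hβ : 0 < β) (μ : ℝ) {θ : ℝ}
    (hθ : |β * θ| ≤ Real.pi / 4) (Λ₀ : ℝ) (n : MatsubaraIdx M) (k : TorusSite 2 L) (j : Fin 2) (m : ℕ) (σ : Fin 2) :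
    ((hubbardCutoffWeight L M β μ Λ₀ (n, k + m • (Pi.single j (1 : ZMod L) : TorusSite 2 L)) : ℝ) : ℂ) *
        shiftedFreeSymbol L M β μ θ ((n, k + m • (Pi.single j (1 : ZMod L) : TorusSite 2 L)), σ) =
      uvShiftedMomentumSymbolFn (β * (L : ℝ) ^ 2) θ Λ₀ (matsubaraFreq β M n) (nambuXi L μ k + 2 * Real.cos (latticeMomentum L k j))
        (latticeMomentum L k j + m * (2 * Real.pi / L)) := by
  rw [uvShiftedSymbol_eq_uvShiftedSymbolFn hβ μ hθ, uvShiftedSymbolFn_eq_uvShiftedSymbolFnXi, uvShiftedMomentumSymbolFn, nambuXi_add_smul_single]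

end Literature.MathematicalPhysics.QuantumLattice

end
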